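import Summits.CriticalPhenomena.SAWScalingLimit.Theses.SAWExpectedSignature
import Literature.Probability.RandomPlanarGeometry.SLEExistenceNeEightHolds
import Literature.Probability.RandomPlanarGeometry.CritPercSLESimplePathHolds
import Literature.Probability.RandomPlanarGeometry.CaratheodoryHalfPlaneProofs
import Literature.Probability.RandomPlanarGeometry.LocalMartingaleProofs
import Literature.Probability.RandomPlanarGeometry.ConformalRestrictionProofs
import Literature.Probability.RandomPlanarGeometry.SimpleCurves
import HarnessLib.Audit

/-!
# Birth skeleton — piece `SLESigDeterminacy` (crux) of the split of crux `MomentsIdentifySLE` (stmt-CriticalPhenomena-5888)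

§0 of this file is `Cruxes/MomentsIdentifySLE/Split.lean` VERBATIM (the three piece `def`s and the proved
assembly `MomentsIdentifySLE_of_subs`): crux work-files are not built as importable modules on the farm, so a
skeleton that must conclude the piece BY NAME re-declares the pieces in their own namespace instead of importing
them. §1 is the skeleton proper.

§1: two registered stubs and the kernel-checked composition `SLESigDeterminacy_of` (crux-strategist BC3).

* `stub_expSigRadius` (ρ, the OPEN input, size XL): the expected signature of a Young-regular chordal SLE(8/3)
  law has INFINITE RADIUS OF CONVERGENCE — `Σ_n r^n · max_(|w| = n) |E S_w| < ∞` for every `r > 0` — the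
  sufficient condition of Chevyrev–Lyons (Ann. Probab. 44 (2016), Prop. 6.1 / Cor. 6.5), and exactly the point
  the crux docstring flags as risky (Boedihardjo–Diehl–Mezzarobba–Ni 2021: FINITE radius for planar Brownian
  motion up to the exit of a disc; `N` forced oscillations of SLE cost only `e^(−cN)`). A refutation of ρ kills
  this LINE, not the piece (weaker determinacy criteria — characteristic functions of unitary developments,
  Chevyrev–Lyons §6.2 — remain).
* `stub_determinacyOfRadius` (Chevyrev–Lyons-type criterion, known in print, size L; PURE — no SLE, no
  domain): two probability laws on curve classes with finite variation moments of all orders (so that the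
  inline coefficients are the genuine Young signatures a.e.), equal expected signatures, one of them with
  infinite radius of convergence ⇒ the signature coefficients have the same JOINT LAW under both (tested on
  bounded continuous functions of finitely many coefficients). Formalisation of Chevyrev–Lyons §6 for the
  inline dyadic-limit coefficients.

`SLESigDeterminacy_of : ρ → criterion → SLESigDeterminacy` is real (no sorry; the SLE law is a probability
measure by `IsSLELaw.isProbabilityMeasure` + `isProjectiveLimit_preWienerMeasure_holds`).
-/

namespace Summit.CriticalPhenomena.SAWScalingLimit.Cruxes.MomentsIdentifySLE.Split

open Summit.CriticalPhenomena.SAWScalingLimit.Theses.SAWExpectedSignature (MomentsIdentifySLE)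

open scoped BigOperators Topology Manifold Classical MeasureTheory ProbabilityTheory Matrix InnerProductSpace ComplexConjugate ContinuousMap
open Filter Set Function TopologicalSpace MeasureTheory

/-- piece 1 (crux): if every lattice expected-signature coefficient converges, the limits are the
expected signature of the chordal SLE(8/3) law of `(D; a, b)`, which is Young-regular. -/
def SigLimitIsSLE : Prop :=
  ∀ (D : Literature.Probability.RandomPlanarGeometry.DobrushinDomain) (a b : ℝ → Literature.Probability.LatticeModels.Site 2), Literature.Probability.RandomPlanarGeometry.SAW.IsEndpointApprox D a b → let pv : ℝ → Literature.Probability.RandomPlanarGeometry.Curve ℂ → ENNReal := fun p c => ⨆ π : ℕ × {u : ℕ → unitInterval // Monotone u}, ∑ i ∈ Finset.range π.1, edist (c (π.2.1 (i + 1))) (c (π.2.1 i)) ^ p; let sig : List (Fin 2) → Literature.Probability.RandomPlanarGeometry.Curve ℂ → ℝ := fun w c => limUnder Filter.atTop (fun n : ℕ => ∑ k ∈ (Finset.univ : Finset (Fin w.length → Fin (2 ^ n))).filter (fun k => StrictMono k), ∏ j : Fin w.length, (if w.get j = 0 then Complex.re else Complex.im) (c (Set.projIcc (0 : ℝ) 1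 zero_le_one ((((k j : ℕ) : ℝ) + 1) / 2 ^ n)) - c (Set.projIcc (0 : ℝ) 1 zero_le_one (((k j : ℕ) : ℝ) / 2 ^ n)))); let rep : Literature.Probability.RandomPlanarGeometry.CurveClass ℂ → Literature.Probability.RandomPlanarGeometry.Curve ℂ := fun x => (Literature.Probability.RandomPlanarGeometry.CurveClass.surjective_mk x).choose; let poly : (δ : ℝ) → Literature.Probability.RandomPlanarGeometry.SAW.DomainSAW D.carrier δ (a δ) (b δ) → Literature.Probability.RandomPlanarGeometry.Curve ℂ := fun δ γ => ⟨γ.walk.toCurve (Literature.Probability.LatticeModels.meshPoint δ)⟩; ∀ μ : MeasureTheory.Measure (Literature.Probability.RandomPlanarGeometry.CurveClass ℂ), Literature.Probability.RandomPlanarGeometry.IsSLELaw ((8 : NNReal) / 3) D μ → ∀ s : List (Fin 2) → ℝ, (∀ w : List (Fin 2), Filter.Tendsto (fun δ => ∫ γ, sig w (poly δ γ) ∂(Literature.Probability.RandomPlanarGeometry.SAW.law D.carrier δ (a δ) (b δ))) (nhdsWithin 0 (Set.Ioi 0)) (nhds (s w))) → ∃ q : ℝ, 1 ≤ q ∧ q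 < 2 ∧ (∀ n : ℕ, ∫⁻ x, pv q (rep x) ^ (n : ℝ) ∂μ ≠ ⊤) ∧ ∀ w : List (Fin 2), MeasureTheory.Integrable (fun x => sig w (rep x)) μ ∧ ∫ x, sig w (rep x) ∂μ = s w

/-- piece 2 (crux): expected-signature determinacy anchored at a Young-regular SLE(8/3) law — equal
expected signatures (with finite variation moments of all orders on both sides) force equal joint laws of
the signature coefficients. -/
def SLESigDeterminacy : Prop :=
  ∀ (D : Literature.Probability.RandomPlanarGeometry.DobrushinDomain), let pv : ℝ → Literature.Probability.RandomPlanarGeometry.Curve ℂ → ENNReal := fun p c => ⨆ π : ℕ × {u : ℕ → unitInterval // Monotone u}, ∑ i ∈ Finset.range π.1, edist (c (π.2.1 (i + 1))) (c (π.2.1 i)) ^ p; let sig : List (Fin 2) → Literature.Probability.RandomPlanarGeometry.Curve ℂ → ℝ := fun w c => limUnder Filter.atTop (fun n : ℕ => ∑ k ∈ (Finset.univ : Finset (Fin w.length → Fin (2 ^ n))).filter (fun k => StrictMono k), ∏ j : Fin w.length, (if w.get j = 0 then Complex.re else Complex.im) (c (Set.projIcc (0 : ℝ) 1 zero_le_one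 ((((k j : ℕ) : ℝ) + 1) / 2 ^ n)) - c (Set.projIcc (0 : ℝ) 1 zero_le_one (((k j : ℕ) : ℝ) / 2 ^ n)))); let rep : Literature.Probability.RandomPlanarGeometry.CurveClass ℂ → Literature.Probability.RandomPlanarGeometry.Curve ℂ := fun x => (Literature.Probability.RandomPlanarGeometry.CurveClass.surjective_mk x).choose; ∀ (p q : ℝ), 1 ≤ p → p < 2 → 1 ≤ q → q < 2 → ∀ μ ν : MeasureTheory.Measure (Literature.Probability.RandomPlanarGeometry.CurveClass ℂ), Literature.Probability.RandomPlanarGeometry.IsSLELaw ((8 : NNReal) / 3) D μ → MeasureTheory.IsProbabilityMeasure ν → (∀ n : ℕ, ∫⁻ x, pv q (rep x) ^ (n : ℝ) ∂μ ≠ ⊤) → (∀ n : ℕ, ∫⁻ x, pv p (rep x) ^ (n : ℝ) ∂ν ≠ ⊤) → (∀ w : List (Fin 2), MeasureTheory.Integrable (fun x => sig w (rep x)) μ ∧ MeasureTheory.Integrable (fun x => sig w (rep x)) ν ∧ ∫ x, sig w (rep x) ∂ν = ∫ x, sig w (rep x) ∂μ) → ∀ (ws : List (List (Fin 2))) (F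 : BoundedContinuousFunction (Fin ws.length → ℝ) ℝ), ∫ x, F (fun i => sig (ws.get i) (rep x)) ∂ν = ∫ x, F (fun i => sig (ws.get i) (rep x)) ∂μ

/-- piece 3 (support): a simple law pinned at `a = D.pt 0` with finite variation moments whose signature
coefficients have the same joint law as under a Young-regular SLE(8/3) law of `D` is that law. -/
def SimpleLawFromSigLaw : Prop :=
  ∀ (D : Literature.Probability.RandomPlanarGeometry.DobrushinDomain), let pv : ℝ → Literature.Probability.RandomPlanarGeometry.Curve ℂ → ENNReal := fun p c => ⨆ π : ℕ × {u : ℕ → unitInterval // Monotone u}, ∑ i ∈ Finset.range π.1, edist (c (π.2.1 (i + 1))) (c (π.2.1 i)) ^ p; let sig : List (Fin 2) → Literature.Probability.RandomPlanarGeometry.Curve ℂ → ℝ := fun w c => limUnder Filter.atTop (fun n : ℕ => ∑ k ∈ (Finset.univ : Finset (Fin w.length → Fin (2 ^ n))).filter (fun k => StrictMono k), ∏ j : Fin w.length, (if w.get j = 0 then Complex.re else Complex.im) (c (Set.projIcc (0 : ℝ) 1 zero_le_one ((((k j : ℕ) : ℝ) + 1) / 2 ^ n)) - c (Set.projIcc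 (0 : ℝ) 1 zero_le_one (((k j : ℕ) : ℝ) / 2 ^ n)))); let rep : Literature.Probability.RandomPlanarGeometry.CurveClass ℂ → Literature.Probability.RandomPlanarGeometry.Curve ℂ := fun x => (Literature.Probability.RandomPlanarGeometry.CurveClass.surjective_mk x).choose; ∀ (p q : ℝ), 1 ≤ p → p < 2 → 1 ≤ q → q < 2 → ∀ μ ν : MeasureTheory.Measure (Literature.Probability.RandomPlanarGeometry.CurveClass ℂ), Literature.Probability.RandomPlanarGeometry.IsSLELaw ((8 : NNReal) / 3) D μ → MeasureTheory.IsProbabilityMeasure ν → (∀ n : ℕ, ∫⁻ x, pv q (rep x) ^ (n : ℝ) ∂μ ≠ ⊤) → (∀ n : ℕ, ∫⁻ x, pv p (rep x) ^ (n : ℝ) ∂ν ≠ ⊤) → ν (Literature.Probability.RandomPlanarGeometry.CurveClass.simple)ᶜ = 0 → ν {x | x.source ≠ D.pt 0} = 0 → (∀ (ws : List (List (Fin 2))) (F : BoundedContinuousFunction (Fin ws.length → ℝ) ℝ), ∫ x, F (fun i => sig (ws.get i) (rep x)) ∂ν = ∫ x, F (fun i => sig (ws.get i) (rep x)) ∂μ)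 → ν = μ

/-- ASSEMBLY of the split: the three pieces imply the crux `MomentsIdentifySLE` by name. -/
theorem MomentsIdentifySLE_of_subs :
    SigLimitIsSLE → SLESigDeterminacy → SimpleLawFromSigLaw → MomentsIdentifySLE := by
  intro h1 h2 h3 D a b hab
  dsimp only
  intro p hp1 hp2 ν hν hmom hsimp hsrc hsig
  -- the chordal SLE(8/3) law `μ` of `D` exists (Rohde–Schramm Thm 5.1 / 7.1, proved in the tree)
  obtain ⟨μ, hμ⟩ :=
    Literature.Probability.RandomPlanarGeometry.exists_isSLELaw_of_ne_eight (κ := (8 : NNReal) / 3)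
      (by positivity) (by norm_num) D
  -- piece 1, fed with the lattice limits carried by `ν` (hypothesis (iv)): `μ` is Young-regular with
  -- exponent `q`, its signature coefficients are integrable and their expectations are those limits
  have h1' := h1 D a b hab
  dsimp only at h1'
  obtain ⟨q, hq1, hq2, hmomμ, hS⟩ := h1' μ hμ _ (fun w => (hsig w).2)
  -- piece 2: the joint laws of the signature coefficients under `ν` and `μ` agree
  have h2' := h2 D
  dsimp only at h2'
  have hlaw := h2' p q hp1 hp2 hq1 hq2 μ ν hμ hν hmomμ hmom
    (fun w => ⟨(hS w).1, (hsig w).1, (hS w).2.symm⟩)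
  -- piece 3: a simple pinned finite-moment law with the SLE signature law is the SLE law
  have h3' := h3 D
  dsimp only at h3'
  have hνμ : ν = μ := h3' p q hp1 hp2 hq1 hq2 μ ν hμ hν hmomμ hmom hsimp hsrc hlaw
  rw [hνμ]
  exact hμ

end Summit.CriticalPhenomena.SAWScalingLimit.Cruxes.MomentsIdentifySLE.Split


namespace Summit.CriticalPhenomena.SAWScalingLimit.Cruxes.MomentsIdentifySLE.Birth.SLESigDeterminacy

open Summit.CriticalPhenomena.SAWScalingLimit.Cruxes.MomentsIdentifySLE.Split
open scoped BigOperators Topology Classical MeasureTheory ProbabilityTheory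
open Filter Set Function TopologicalSpace MeasureTheory

/-- stub ρ — infinite radius of convergence of the expected signature of a Young-regular SLE(8/3) law
(Chevyrev–Lyons 2016 Prop. 6.1 hypothesis; OPEN, cf. Boedihardjo–Diehl–Mezzarobba–Ni 2021). -/
theorem stub_expSigRadius :
    ∀ (D : Literature.Probability.RandomPlanarGeometry.DobrushinDomain), let pv : ℝ → Literature.Probability.RandomPlanarGeometry.Curve ℂ → ENNReal := fun p c => ⨆ π : ℕ × {u : ℕ → unitInterval // Monotone u}, ∑ i ∈ Finset.range π.1, edist (c (π.2.1 (i + 1))) (c (π.2.1 i)) ^ p; let sig : List (Fin 2) → Literature.Probability.RandomPlanarGeometry.Curve ℂ → ℝ := fun w c => limUnder Filter.atTop (fun n : ℕ => ∑ k ∈ (Finset.univ : Finset (Fin w.length → Fin (2 ^ n))).filter (fun k => StrictMono k), ∏ j : Fin w.length, (if w.get j = 0 then Complex.re else Complex.im) (c (Set.projIcc (0 : ℝ) 1 zero_le_one ((((k j : ℕ) : ℝ) + 1) / 2 ^ n)) - c (Set.projIcc (0 : ℝ) 1 zero_le_one (((k j : ℕ) : ℝ) / 2 ^ n)))); let rep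 : Literature.Probability.RandomPlanarGeometry.CurveClass ℂ → Literature.Probability.RandomPlanarGeometry.Curve ℂ := fun x => (Literature.Probability.RandomPlanarGeometry.CurveClass.surjective_mk x).choose; ∀ (q : ℝ), 1 ≤ q → q < 2 → ∀ μ : MeasureTheory.Measure (Literature.Probability.RandomPlanarGeometry.CurveClass ℂ), Literature.Probability.RandomPlanarGeometry.IsSLELaw ((8 : NNReal) / 3) D μ → (∀ n : ℕ, ∫⁻ x, pv q (rep x) ^ (n : ℝ) ∂μ ≠ ⊤) → (∀ w : List (Fin 2), MeasureTheory.Integrable (fun x => sig w (rep x)) μ) → ∀ r : ℝ, 0 < r → Summable (fun n : ℕ => r ^ n * ⨆ w : {w : List (Fin 2) // w.length = n}, |∫ x, sig w.1 (rep x) ∂μ|) := by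
  sorry

/-- stub (criterion) — Chevyrev–Lyons-type determinacy, pure form: finite variation moments of all orders on
both sides, equal expected signatures, infinite radius of convergence ⇒ equal joint laws of the coefficients
(Chevyrev–Lyons, Ann. Probab. 44 (2016), Prop. 6.1 and Cor. 6.5; known in print, to be formalised). -/
theorem stub_determinacyOfRadius :
    let pv : ℝ → Literature.Probability.RandomPlanarGeometry.Curve ℂ → ENNReal := fun p c => ⨆ π : ℕ × {u : ℕ → unitInterval // Monotone u}, ∑ i ∈ Finset.range π.1, edist (c (π.2.1 (i + 1))) (c (π.2.1 i)) ^ p; let sig : List (Fin 2) → Literature.Probability.RandomPlanarGeometry.Curve ℂ → ℝ := fun w c => limUnder Filter.atTop (fun n : ℕ => ∑ k ∈ (Finset.univ : Finset (Fin w.length → Fin (2 ^ n))).filter (fun k => StrictMono k), ∏ j : Fin w.length, (if w.get j = 0 then Complex.re else Complex.im) (c (Set.projIcc (0 : ℝ) 1 zero_le_one ((((k j : ℕ) : ℝ) + 1) / 2 ^ n)) - c (Set.projIcc (0 : ℝ) 1 zero_le_one (((k j : ℕ) : ℝ) / 2 ^ n)))); let rep : Literature.Probability.RandomPlanarGeometry.CurveClass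 ℂ → Literature.Probability.RandomPlanarGeometry.Curve ℂ := fun x => (Literature.Probability.RandomPlanarGeometry.CurveClass.surjective_mk x).choose; ∀ (p q : ℝ), 1 ≤ p → p < 2 → 1 ≤ q → q < 2 → ∀ μ ν : MeasureTheory.Measure (Literature.Probability.RandomPlanarGeometry.CurveClass ℂ), MeasureTheory.IsProbabilityMeasure μ → MeasureTheory.IsProbabilityMeasure ν → (∀ n : ℕ, ∫⁻ x, pv q (rep x) ^ (n : ℝ) ∂μ ≠ ⊤) → (∀ n : ℕ, ∫⁻ x, pv p (rep x) ^ (n : ℝ) ∂ν ≠ ⊤) → (∀ w : List (Fin 2), MeasureTheory.Integrable (fun x => sig w (rep x)) μ ∧ MeasureTheory.Integrable (fun x => sig w (rep x)) ν ∧ ∫ x, sig w (rep x) ∂ν = ∫ x, sig w (rep x) ∂μ) → (∀ r : ℝ, 0 < r → Summable (fun n : ℕ => r ^ n * ⨆ w : {w : List (Fin 2) // w.length = n}, |∫ x, sig w.1 (rep x) ∂μ|)) → ∀ (ws : List (List (Fin 2))) (F : BoundedContinuousFunction (Fin ws.length → ℝ) ℝ), ∫ x, F (fun i => sig (ws.get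 i) (rep x)) ∂ν = ∫ x, F (fun i => sig (ws.get i) (rep x)) ∂μ := by
  sorry

/-- Composition: ρ and the criterion give the piece `SLESigDeterminacy` by name. -/
theorem SLESigDeterminacy_of :
    (∀ (D : Literature.Probability.RandomPlanarGeometry.DobrushinDomain), let pv : ℝ → Literature.Probability.RandomPlanarGeometry.Curve ℂ → ENNReal := fun p c => ⨆ π : ℕ × {u : ℕ → unitInterval // Monotone u}, ∑ i ∈ Finset.range π.1, edist (c (π.2.1 (i + 1))) (c (π.2.1 i)) ^ p; let sig : List (Fin 2) → Literature.Probability.RandomPlanarGeometry.Curve ℂ → ℝ := fun w c => limUnder Filter.atTop (fun n : ℕ => ∑ k ∈ (Finset.univ : Finset (Fin w.length → Fin (2 ^ n))).filter (fun k => StrictMono k), ∏ j : Fin w.length, (if w.get j = 0 then Complex.re else Complex.im) (c (Set.projIcc (0 : ℝ) 1 zero_le_one ((((k j : ℕ) : ℝ) + 1) / 2 ^ n)) - c (Set.projIcc (0 : ℝ) 1 zero_le_one (((k j : ℕ) : ℝ) / 2 ^ n)))); let rep : Literature.Probability.RandomPlanarGeometry.CurveClass ℂ → Literature.Probability.RandomPlanarGeometry.Curve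 ℂ := fun x => (Literature.Probability.RandomPlanarGeometry.CurveClass.surjective_mk x).choose; ∀ (q : ℝ), 1 ≤ q → q < 2 → ∀ μ : MeasureTheory.Measure (Literature.Probability.RandomPlanarGeometry.CurveClass ℂ), Literature.Probability.RandomPlanarGeometry.IsSLELaw ((8 : NNReal) / 3) D μ → (∀ n : ℕ, ∫⁻ x, pv q (rep x) ^ (n : ℝ) ∂μ ≠ ⊤) → (∀ w : List (Fin 2), MeasureTheory.Integrable (fun x => sig w (rep x)) μ) → ∀ r : ℝ, 0 < r → Summable (fun n : ℕ => r ^ n * ⨆ w : {w : List (Fin 2) // w.length = n}, |∫ x, sig w.1 (rep x) ∂μ|)) →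
    (let pv : ℝ → Literature.Probability.RandomPlanarGeometry.Curve ℂ → ENNReal := fun p c => ⨆ π : ℕ × {u : ℕ → unitInterval // Monotone u}, ∑ i ∈ Finset.range π.1, edist (c (π.2.1 (i + 1))) (c (π.2.1 i)) ^ p; let sig : List (Fin 2) → Literature.Probability.RandomPlanarGeometry.Curve ℂ → ℝ := fun w c => limUnder Filter.atTop (fun n : ℕ => ∑ k ∈ (Finset.univ : Finset (Fin w.length → Fin (2 ^ n))).filter (fun k => StrictMono k), ∏ j : Fin w.length, (if w.get j = 0 then Complex.re else Complex.im) (c (Set.projIcc (0 : ℝ) 1 zero_le_one ((((k j : ℕ) : ℝ) + 1) / 2 ^ n)) - c (Set.projIcc (0 : ℝ) 1 zero_le_one (((k j : ℕ) : ℝ) / 2 ^ n)))); let rep : Literature.Probability.RandomPlanarGeometry.CurveClass ℂ → Literature.Probability.RandomPlanarGeometry.Curve ℂ := fun x => (Literature.Probability.RandomPlanarGeometry.CurveClass.surjective_mk x).choose; ∀ (p q : ℝ), 1 ≤ p → p < 2 → 1 ≤ q → q < 2 → ∀ μ ν : MeasureTheory.Measure (Literature.Probability.RandomPlanarGeometry.CurveClass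 ℂ), MeasureTheory.IsProbabilityMeasure μ → MeasureTheory.IsProbabilityMeasure ν → (∀ n : ℕ, ∫⁻ x, pv q (rep x) ^ (n : ℝ) ∂μ ≠ ⊤) → (∀ n : ℕ, ∫⁻ x, pv p (rep x) ^ (n : ℝ) ∂ν ≠ ⊤) → (∀ w : List (Fin 2), MeasureTheory.Integrable (fun x => sig w (rep x)) μ ∧ MeasureTheory.Integrable (fun x => sig w (rep x)) ν ∧ ∫ x, sig w (rep x) ∂ν = ∫ x, sig w (rep x) ∂μ) → (∀ r : ℝ, 0 < r → Summable (fun n : ℕ => r ^ n * ⨆ w : {w : List (Fin 2) // w.length = n}, |∫ x, sig w.1 (rep x) ∂μ|)) → ∀ (ws : List (List (Fin 2))) (F : BoundedContinuousFunction (Fin ws.length → ℝ) ℝ), ∫ x, F (fun i => sig (ws.get i) (rep x)) ∂ν = ∫ x, F (fun i => sig (ws.get i) (rep x)) ∂μ) →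
    SLESigDeterminacy := by
  intro hρ hc D
  dsimp only
  intro p q hp1 hp2 hq1 hq2 μ ν hμ hν hmomμ hmomν heq
  have hρ' := hρ D
  dsimp only at hρ'
  have hrad := hρ' q hq1 hq2 μ hμ hmomμ (fun w => (heq w).1)
  haveI : Fact Literature.Probability.Process.isProjectiveLimit_preWienerMeasure :=
    ⟨Literature.Probability.RandomPlanarGeometry.isProjectiveLimit_preWienerMeasure_holds⟩
  have hμP : MeasureTheory.IsProbabilityMeasure μ := hμ.isProbabilityMeasure
  dsimp only at hc
  exact hc p q hp1 hp2 hq1 hq2 μ ν hμP hν hmomμ hmomν heq hrad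

/-- The piece from its registered stubs. -/
theorem SLESigDeterminacy_of_stubs : SLESigDeterminacy :=
  SLESigDeterminacy_of stub_expSigRadius stub_determinacyOfRadius

end Summit.CriticalPhenomena.SAWScalingLimit.Cruxes.MomentsIdentifySLE.Birth.SLESigDeterminacy
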